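import Literature.NumberTheory.Sieve.LinearEquationsInPrimesNilsequences
import Literature.NumberTheory.Sieve.LinearEquationsInPrimesEnvelopingSieveDomination
import HarnessLib

/-!
# Linear equations in primes: the Gowers uniformity estimate rests on Props. 10.1 and 10.2

Trunk T-SIEVE (`Literature/NumberTheory/Sieve`). Assembly of
`LinearEquationsInPrimesNilsequences.lean` (Thm. 7.2 of B. Green, T. Tao, *Linear equations in
primes*, Ann. of Math. 171 (2010), from Props. 6.4, 10.1, 10.2, proved there level by level) with
`LinearEquationsInPrimesEnvelopingSieveDomination.lean` (Prop. 6.4 proved: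
`GreenTao2010_pseudorandomDomination_holds`): the Gowers uniformity estimate
`GreenTao2010_gowersUniformity` — and with it the Green–Tao–Ziegler theorem
`GreenTaoZiegler2012_finiteComplexity` — rest on exactly the two propositions of §10, i.e. on the
relative inverse Gowers-norm theorem (Prop. 10.1, from `GI(s)` = Green–Tao–Ziegler 2012, Thm. 1.3)
and the orthogonality of `Λ'_{b,W} - 1` to nilsequences (Prop. 10.2, from `MN(s)` = Green–Tao
2012, Thm. 1.1), taken here as hypotheses in the predicate form of that file (D-0026: they are
not asserted in this tree yet).

## References

* B. Green, T. Tao, *Linear equations in primes*, Ann. of Math. (2) 171 (2010), 1753–1850: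
  Prop. 6.4, Thm. 7.2, Props. 10.1, 10.2 and the paragraph between them, Main Theorem.
* B. Green, T. Tao, T. Ziegler, *An inverse theorem for the Gowers `U^{s+1}[N]`-norm*, Ann. of
  Math. (2) 176 (2012), Thm. 1.3 and the paragraph following it.
-/

namespace Literature.NumberTheory.Sieve

/-- **Thm. 7.2 from Props. 10.1 and 10.2** (Green–Tao 2010, §10, paragraph before Prop. 10.2),
with Prop. 6.4 discharged (`GreenTao2010_pseudorandomDomination_holds`): the Gowers uniformity
estimate `‖Λ'_{b,W} - 1‖_{U^{s+1}[N]} = o(1)` for all `s ≥ 1` follows from the relative inverse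
Gowers-norm theorem and the orthogonality of `Λ'_{b,W} - 1` to nilsequences at every level
`s ≥ 1`. [cite: GreenTao2010, Thm. 7.2 and §10 (proof of Thm. 7.2 before Prop. 10.2)] -/
theorem GreenTao2010_gowersUniformity_of_relativeInverse_of_orthogonality
    (h101 : ∀ s : ℕ, 1 ≤ s → ∀ δ : ℝ, 0 < δ → δ ≤ 1 → ∀ C : ℝ, 20 ≤ C → ∀ A : ℕ → ℝ → ℝ,
      GreenTao2010_relativeInverseAt s δ C A)
    (h102 : ∀ s : ℕ, 1 ≤ s → ∀ (X : Nilmanifold s) (M : ℝ),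
      GreenTao2010_nilsequenceOrthogonalityAt s X M) :
    GreenTao2010_gowersUniformity :=
  GreenTao2010_gowersUniformity_of_props GreenTao2010_pseudorandomDomination_holds h101 h102

/-- **The Green–Tao–Ziegler theorem from Props. 10.1 and 10.2**: with §§4–7 and Apps. A, C, D of
the paper proved in this tree, the generalised Hardy–Littlewood asymptotic for systems of finite
complexity rests on the two propositions of §10 (equivalently, on `GI(s)` and `MN(s)` through
§§10–12). [cite: GreenTao2010, Main Theorem, Thm. 7.2, Props. 10.1–10.2]
[cite: GreenTaoZiegler2012, Thm. 1.3 and the following paragraph] -/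
theorem GreenTaoZiegler2012_finiteComplexity_of_relativeInverse_of_orthogonality
    (h101 : ∀ s : ℕ, 1 ≤ s → ∀ δ : ℝ, 0 < δ → δ ≤ 1 → ∀ C : ℝ, 20 ≤ C → ∀ A : ℕ → ℝ → ℝ,
      GreenTao2010_relativeInverseAt s δ C A)
    (h102 : ∀ s : ℕ, 1 ≤ s → ∀ (X : Nilmanifold s) (M : ℝ),
      GreenTao2010_nilsequenceOrthogonalityAt s X M) :
    GreenTaoZiegler2012_finiteComplexity :=
  GreenTaoZiegler2012_finiteComplexity_of_gowersUniformity
    (GreenTao2010_gowersUniformity_of_relativeInverse_of_orthogonality h101 h102)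

end Literature.NumberTheory.Sieve
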